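import Summits.ABC.IUTFork.Repair.RHReachLedger
import Summits.ABC.IUTFork.Conditional.AbcOfSGenuineKWindowThetaSzpiroBadBoth
import HarnessLib

/-!
# R-H ROUND 2 Q2(27) — «S restricted to Σ₂₇ ⇒ (weakened) Cor 3.12 ⇒ abc» as KERNEL TARGETS for row 27 `reach-ledger`
# (Σ₂₇ = frey : Szpiro-bad ∧ window, the KEEP-on-stratum of ROUND1.tsv row 27, 1064/1076 = 98.9 %)

abc-iut cell, D-0079 RESCUE sub-cell R-H, rung LADDER-ABC:A2.RESCUE.H; pair n = 10 typer abc-iut-rh-typ-10 (director-abc g3 R-H ROUND 2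
TRANCHE 1 payload (6), 2026-08-26T19:46:32Z). TAKES NO SIDE on [IUTchIII] Cor. 3.12 or on any author; typed ≠ proved; instantiated ≠ endorsed;
nothing here asserts abc proved or refuted. Three bookkeeping `def … : Prop` — HYPOTHESIS SHAPES / TARGETS, claim-tagged, never asserted, never
Literature facts — and composition theorems BY NAME over landed tails; no instance, no notation; binder texts copied VERBATIM from branch C's
certificate of record `Conditional.abc_of_SH_v10K_window_szpiroBadBoth` (abc-iut-c312-d1, p450130).

THE THREE TYPED OBJECTS (Σ₂₇ := `P ∈ UP`, `l` prime `≥ 5`, admissible (`AdmitsCore`, `CondP2/5/6`), SZPIRO-BAD `(P, l)` (the verbatim disjunction of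
p450130), datum `T : Cor22.ThetaVolumeDatumAt P l` OFF THE DEPTH LOCUS (the verbatim «window» antecedent of `hSHwBad`)):
* «S restricted to Σ₂₇» = `HStar27OnSigma27` — row 27's ledger `Repair.RH.ReachLedger.LedgerCell` (p464022) at every bad place of the genuine
  `K`-level datum `Cor312Prov.pilotDataOfK T.D T.K`, with the dictionary of record `e_w := e(w ∣ p)` (`ramificationIdx`), `m_q(w) := P_w` (the
  q-pilot degree, `Cor312Prov.exists_nat_qPilot_pilotDataOfK`) — `LedgerAtDatum T`, = `HStarReachLedgerK T.D e mq` at that dictionary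
  (`ledgerAtDatum_iff_hStarReachLedgerK`) — demanded ONLY on Σ₂₇.
* «(weakened) Cor 3.12 on Σ₂₇» = `Cor312OnSigma27` — the NUMBER-level [IUTchIII] Cor. 3.12 `T.Cor312NonarchOf` at every Σ₂₇ datum, which IS the
  typed `Cor312.Setting.Statement` of abc-iut-c312-7's `Thm311.Real.settingPrVolSharp (pilotDataOfK T.D T.K) …` at the chosen realising ideles
  (abc-iut-s2-p10 `Conditional.GenuineKStatement.statement_chosen_iff_cor312NonarchOf`, abc-iut-s2-p7 `statement_settingPrVolSharp_pilotDataOfK_iff_datum`).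
  «Weakened» = demanded on Σ₂₇ only (off Σ₂₇ the certificate's other binders carry the load: NUM on the depth locus, abc-iut-c312-d1's theorem
  `Cor22.ThetaVolumeDatumAt.cor312Of_of_szpiro` at Szpiro-good points).
* «abc» = `_root_.ABC` through abc-iut-s2's tail `ThetaPartII.ABC_of_cor312_of_hullRegime` ([IUTchIV] Thm 1.10 ⟹ Cor 2.2 ⟹ Cor 2.3) with its CONE
  binder `hreg` and the NUM binder `hNumBad` VERBATIM (same count and texts as p450130 with `hSHwBad ↦` the Σ₂₇ statement). The constant is NOT
  worse here: Σ₂₇ restricts the DATUM (Szpiro-bad ∧ window), not the prime `l`, and the complement is covered by the certificate's own binders;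
  an `l`-window stratum (threshold rows 3/4/5) is where «worse constant» bites — not this row.
THE TWO ARROWS: `K2Target27` («S|Σ₂₇ ⇒ Cor 3.12|Σ₂₇» per datum: `LedgerAtDatum T → T.Cor312NonarchOf` on Σ₂₇ — row 27's k2 CRUX as a kernel
target; its decomposition of record: (α) REALISATION of the ledger integers `cellReachSlack` by (Ind2)-movers — abc-iut-rp-d3's
`RHSlotReachGlue.multiReach_of_slotReachWindow` engine run with deficits —, (L1) `RH.ReachLedgerVolume.reachGain_le_cellSlack` /
`levels_le_cellSlack` (p466959 / p467585, LANDED), (β) label bookkeeping into abc-iut-rp-s2's `ObstructionSS28Window.statement_iff_avg_cellSlack`)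
and `abc_of_cor312OnSigma27` («Cor 3.12|Σ₂₇ ∧ NUM(deep ∧ bad) ∧ CONE ⇒ abc», PROVED here from the tails). Composite:
`abc_of_k2Target27_of_hStar27OnSigma27`. [cite: Mochizuki2012, IUTchIII Cor. 3.12 p. 173–174; IUTchIV Thm. 1.10 p. 22–31, Cor. 2.2 p. 43–47]
[cite: DupuyHilado2025, §1 (1.1), §3.9] [claim: Mochizuki2012, status: disputed]
-/

noncomputable section

open Set Function NumberField IsDedekindDomain

namespace Summit.ABC.IUTFork.Repair.RH.ReachLedgerQ2

open Thm311 Thm311.Real Cor312 Cor312Vol Cor312Prov Literature.IUT.LogThetaLattice Literature.IUT.LogVolume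
  Literature.IUT.HodgeTheaters Literature.IUT.LogVolume.ThetaData Summit.ABC.IUTFork.Repair.RH.ReachLedger
open Literature.NumberTheory.DiophantineGeometry.GenEll Summit.ABC.ABC.Theorems Summit.ABC.IUTFork.Conditional

/-! ## §1. «S restricted to Σ₂₇»: row 27's ledger at a genuine datum, with the dictionary of record -/

/-- **Row 27's ledger AT THE GENUINE DATUM `T`** (dictionary of record, as abc-iut-rh-typ-10's round-1 `RHSharpUpperEdge.HStarSharpUpperEdge`): at
every place `w ∣ p` of `T.K` in `S`, with `e_w = e(w ∣ p)` and the q-pilot degree `P_w ∈ ℕ` (`‖t_{q,w}‖ = p^{−P_w/e_w}`), the per-place ledger cell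
`LedgerCell l⋆ p e_w P_w` of `Repair.RH.ReachLedger` (p464022): `0 ≤ Σ_{j=1}^{l⋆} ⌊((j+1)·D(p,e_w) − (j²−1)·P_w − e_w)/e_w⌋`. Hypothesis shape.
[R-H candidate, hypothesis — not a fact] [claim: Mochizuki2012, status: disputed] -/
@[claim "Mochizuki2012" "disputed"]
def LedgerAtDatum {P : NFPoint} {l : ℕ} (T : Cor22.ThetaVolumeDatumAt P l) : Prop :=
  letI := T.instFieldF; letI := T.instNumberFieldF; letI := T.instAlgebraF; letI := T.instFieldK;
  letI := T.instNumberFieldK; letI := T.instAlgebraK; letI := T.instFieldFbar; letI := T.instAlgebraFbar;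
  letI := T.instAlgebraKFbar; letI := T.instIsElliptic;
  ∀ (pp : Nat.Primes) (w : (thetaIndex (pilotDataOfK T.D T.K)).Fibre (.inr pp)),
    haveI : Fact (pp : ℕ).Prime := ⟨pp.2⟩
    placeOf (pilotDataOfK T.D T.K) pp.1 w ∈ (pilotDataOfK T.D T.K).S →
      ∀ Pw : ℕ, (pilotDataOfK T.D T.K).qPilot (placeOf (pilotDataOfK T.D T.K) pp.1 w) = Pw →
        LedgerCell (thetaIndex (pilotDataOfK T.D T.K)).lstar (pp : ℕ)
          ((placeOf (pilotDataOfK T.D T.K) pp.1 w).asIdeal.ramificationIdx ℤ) (Pw : ℤ)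

/-- `LedgerAtDatum T` IS row 27's `HStarReachLedgerK T.D e mq` at the dictionary `e = e(w ∣ p)`, `mq = P_w` (given the q-pilot degrees as
naturals `Pw`, `Cor312Prov.exists_nat_qPilot_pilotDataOfK`). [folklore] -/
theorem ledgerAtDatum_iff_hStarReachLedgerK {P : NFPoint} {l : ℕ} (T : Cor22.ThetaVolumeDatumAt P l) :
    letI := T.instFieldF; letI := T.instNumberFieldF; letI := T.instAlgebraF; letI := T.instFieldK;
    letI := T.instNumberFieldK; letI := T.instAlgebraK; letI := T.instFieldFbar; letI := T.instAlgebraFbar;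
    letI := T.instAlgebraKFbar; letI := T.instIsElliptic;
    ∀ (Pw : ∀ pp : Nat.Primes, (thetaIndex (pilotDataOfK T.D T.K)).Fibre (.inr pp) → ℕ),
      (∀ (pp : Nat.Primes) (w : (thetaIndex (pilotDataOfK T.D T.K)).Fibre (.inr pp)), haveI : Fact (pp : ℕ).Prime := ⟨pp.2⟩;
        (pilotDataOfK T.D T.K).qPilot (placeOf (pilotDataOfK T.D T.K) pp.1 w) = Pw pp w) →
      (LedgerAtDatum T ↔
        HStarReachLedgerK T.D
          (fun pp w => haveI : Fact (pp : ℕ).Prime := ⟨pp.2⟩; (placeOf (pilotDataOfK T.D T.K) pp.1 w).asIdeal.ramificationIdx ℤ)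
          (fun pp w => (Pw pp w : ℤ))) := by
  intro Pw hPw
  constructor
  · intro h pp w hw
    exact h pp w hw (Pw pp w) (hPw pp w)
  · intro h pp w hw P' hP'
    have hP : Pw pp w = P' := by exact_mod_cast (hPw pp w).symm.trans hP'
    subst hP
    exact h pp w hw

/-- **«S RESTRICTED TO Σ₂₇»** — row 27's ledger demanded ONLY at admissible SZPIRO-BAD `(P, l)` and data OFF the depth locus (the «window»):
the antecedents are those of p450130's `hSHwBad` VERBATIM. Hypothesis shape; ROUND1.tsv row 27's KEEP-on-stratum (frey : szpiro-bad ∧ window,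
1064/1076). [R-H candidate, hypothesis — not a fact] [claim: Mochizuki2012, status: disputed] -/
@[claim "Mochizuki2012" "disputed"]
def HStar27OnSigma27 : Prop :=
  ∀ (P : NFPoint), P ∈ UP → ∀ (l : ℕ), l.Prime → 5 ≤ l →
    Cor22.AdmitsCore P → Cor22.CondP2 P l → Cor22.CondP5 P l → Cor22.CondP6 P l →
    (((l : ℝ) + 5) / 4 < (Cor22.dmod P : ℝ) ∨
      6 * l * (((l : ℝ) + 5) - 4 * Cor22.dmod P) / (((l : ℝ) + 4) * ((l : ℝ) - 3))
          * (P.logDiff + (1 - 1 / (l : ℝ)) * Cor22.logCondAvoid P {2, l})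
        + 6 * l * ((l : ℝ) + 5) / (((l : ℝ) + 4) * ((l : ℝ) - 3)) * Real.log Real.pi < Cor22.logQAvoid P {2, l}) →
    ∀ (T : Cor22.ThetaVolumeDatumAt P l), letI := T.instFieldF; letI := T.instNumberFieldF; letI := T.instAlgebraF; letI := T.instFieldK;
      letI := T.instNumberFieldK; letI := T.instAlgebraK; letI := T.instFieldFbar; letI := T.instAlgebraFbar;
      letI := T.instAlgebraKFbar; letI := T.instIsElliptic;
    ¬ (∃ (pp : Nat.Primes) (_ : 2 < (pp : ℕ)) (i : Fin (thetaIndex (pilotDataOfK T.D T.K)).lstar)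
        (x₀ : (thetaIndex (pilotDataOfK T.D T.K)).Fibre (.inr pp)),
      haveI : Fact (pp : ℕ).Prime := ⟨pp.2⟩
      ((pp : ℕ) : ℝ) ^ ((((i : ℕ) : ℝ) + 2) * (4 + 2 * Real.logb (pp : ℕ) (Module.finrank ℚ T.K)) + 1) *
        ‖(exists_realising_qIdeles_pilotDataOfK T.D).choose pp x₀‖ ^ (((i : ℕ) + 1) ^ 2 - 1) < 1) →
    LedgerAtDatum T

/-! ## §2. «(weakened) Cor 3.12 on Σ₂₇» and the first arrow as a kernel TARGET -/

/-- **«COR 3.12 ON Σ₂₇»** — the NUMBER-level [IUTchIII] Cor. 3.12 `T.Cor312NonarchOf` (Dupuy–Hilado (1.1) for the datum's genuine input) at every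
Σ₂₇ datum; by abc-iut-s2-p10's `GenuineKStatement.statement_chosen_iff_cor312NonarchOf` this IS the typed `Cor312.Setting.Statement` of
`Thm311.Real.settingPrVolSharp (pilotDataOfK T.D T.K) …` at the chosen realising ideles, datum by datum. Hypothesis shape / target.
[claim: Mochizuki2012, status: disputed] [cite: Mochizuki2012, IUTchIII Cor. 3.12 p. 173–174] [cite: DupuyHilado2025, §1 (1.1)] -/
@[claim "Mochizuki2012" "disputed"]
def Cor312OnSigma27 : Prop :=
  ∀ (P : NFPoint), P ∈ UP → ∀ (l : ℕ), l.Prime → 5 ≤ l →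
    Cor22.AdmitsCore P → Cor22.CondP2 P l → Cor22.CondP5 P l → Cor22.CondP6 P l →
    (((l : ℝ) + 5) / 4 < (Cor22.dmod P : ℝ) ∨
      6 * l * (((l : ℝ) + 5) - 4 * Cor22.dmod P) / (((l : ℝ) + 4) * ((l : ℝ) - 3))
          * (P.logDiff + (1 - 1 / (l : ℝ)) * Cor22.logCondAvoid P {2, l})
        + 6 * l * ((l : ℝ) + 5) / (((l : ℝ) + 4) * ((l : ℝ) - 3)) * Real.log Real.pi < Cor22.logQAvoid P {2, l}) →
    ∀ (T : Cor22.ThetaVolumeDatumAt P l), letI := T.instFieldF; letI := T.instNumberFieldF; letI := T.instAlgebraF; letI := T.instFieldK;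
      letI := T.instNumberFieldK; letI := T.instAlgebraK; letI := T.instFieldFbar; letI := T.instAlgebraFbar;
      letI := T.instAlgebraKFbar; letI := T.instIsElliptic;
    ¬ (∃ (pp : Nat.Primes) (_ : 2 < (pp : ℕ)) (i : Fin (thetaIndex (pilotDataOfK T.D T.K)).lstar)
        (x₀ : (thetaIndex (pilotDataOfK T.D T.K)).Fibre (.inr pp)),
      haveI : Fact (pp : ℕ).Prime := ⟨pp.2⟩
      ((pp : ℕ) : ℝ) ^ ((((i : ℕ) : ℝ) + 2) * (4 + 2 * Real.logb (pp : ℕ) (Module.finrank ℚ T.K)) + 1) *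
        ‖(exists_realising_qIdeles_pilotDataOfK T.D).choose pp x₀‖ ^ (((i : ℕ) + 1) ^ 2 - 1) < 1) →
    T.Cor312NonarchOf

/-- **`K2Target27` — THE FIRST ARROW «S|Σ₂₇ ⇒ Cor 3.12|Σ₂₇» AS A KERNEL TARGET (row 27's k2 CRUX).** At every Σ₂₇ datum: `LedgerAtDatum T →
T.Cor312NonarchOf`. NOT proved here. Decomposition of record: (α) realisation of `cellReachSlack` by (Ind2)-movers with deficits (engine:
`RHSlotReachGlue.multiReach_of_slotReachWindow`), (L1) `RH.ReachLedgerVolume.levels_le_cellSlack` (LANDED), (β) label bookkeeping into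
`ObstructionSS28Window.statement_iff_avg_cellSlack`, then `GenuineKStatement.statement_chosen_iff_cor312NonarchOf`. Target shape only.
[claim: Mochizuki2012, status: disputed] -/
@[claim "Mochizuki2012" "disputed"]
def K2Target27 : Prop :=
  ∀ (P : NFPoint), P ∈ UP → ∀ (l : ℕ), l.Prime → 5 ≤ l →
    Cor22.AdmitsCore P → Cor22.CondP2 P l → Cor22.CondP5 P l → Cor22.CondP6 P l →
    (((l : ℝ) + 5) / 4 < (Cor22.dmod P : ℝ) ∨
      6 * l * (((l : ℝ) + 5) - 4 * Cor22.dmod P) / (((l : ℝ) + 4) * ((l : ℝ) - 3))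
          * (P.logDiff + (1 - 1 / (l : ℝ)) * Cor22.logCondAvoid P {2, l})
        + 6 * l * ((l : ℝ) + 5) / (((l : ℝ) + 4) * ((l : ℝ) - 3)) * Real.log Real.pi < Cor22.logQAvoid P {2, l}) →
    ∀ (T : Cor22.ThetaVolumeDatumAt P l), letI := T.instFieldF; letI := T.instNumberFieldF; letI := T.instAlgebraF; letI := T.instFieldK;
      letI := T.instNumberFieldK; letI := T.instAlgebraK; letI := T.instFieldFbar; letI := T.instAlgebraFbar;
      letI := T.instAlgebraKFbar; letI := T.instIsElliptic;
    ¬ (∃ (pp : Nat.Primes) (_ : 2 < (pp : ℕ)) (i : Fin (thetaIndex (pilotDataOfK T.D T.K)).lstar)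
        (x₀ : (thetaIndex (pilotDataOfK T.D T.K)).Fibre (.inr pp)),
      haveI : Fact (pp : ℕ).Prime := ⟨pp.2⟩
      ((pp : ℕ) : ℝ) ^ ((((i : ℕ) : ℝ) + 2) * (4 + 2 * Real.logb (pp : ℕ) (Module.finrank ℚ T.K)) + 1) *
        ‖(exists_realising_qIdeles_pilotDataOfK T.D).choose pp x₀‖ ^ (((i : ℕ) + 1) ^ 2 - 1) < 1) →
    LedgerAtDatum T → T.Cor312NonarchOf

/-- The first arrow applied: `K2Target27 ∧ HStar27OnSigma27 ⟹ Cor312OnSigma27` (pure logic). [folklore] -/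
theorem cor312OnSigma27_of_k2Target27 (hK2 : K2Target27) (hS : HStar27OnSigma27) : Cor312OnSigma27 :=
  fun P hP l hl h5 hc h2 h5' h6 hbad T hwin =>
    hK2 P hP l hl h5 hc h2 h5' h6 hbad T hwin (hS P hP l hl h5 hc h2 h5' h6 hbad T hwin)

/-! ## §3. THE SECOND ARROW, PROVED: «Cor 3.12 on Σ₂₇ ∧ NUM(deep ∧ bad) ∧ CONE ⟹ abc» — p450130's composition with `hSHwBad ↦ Cor312OnSigma27` -/

/-- **`abc_of_cor312OnSigma27` — THE SECOND ARROW.** `ABC` from «Cor 3.12 on Σ₂₇» together with the two remaining binders of branch C's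
certificate of record p450130 VERBATIM: `hNumBad` (the number-level Corollary ON the depth locus of Szpiro-bad points) and `hreg` (the CONE hull
estimate). Per admissible `(P, l)`: Szpiro-good ⟹ abc-iut-c312-d1's theorem (`Cor22.forall_cor312Of_of_szpiroBad`); Szpiro-bad and deep ⟹ `hNumBad`;
Szpiro-bad and off the depth locus (Σ₂₇) ⟹ `T.Cor312NonarchOf ⟹ T.Cor312Of` (`Cor22.ThetaVolumeDatumAt.cor312Of_of_nonarch`); then abc-iut-s2's
tail `ThetaPartII.ABC_of_cor312_of_hullRegime`. Explicit 3 = C312(Σ₂₇) · NUM(deep ∧ bad) · CONE — the same count as p450130 with the S_H binder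
replaced by the number-level statement on the same stratum. «`ABC` follows from these hypotheses AS TYPED»; no side taken on [IUTchIII] Cor. 3.12.
[claim: Mochizuki2012, status: disputed] [cite: Mochizuki2012, IUTchIII Cor. 3.12 p. 173–174; IUTchIV Thm. 1.10 p. 22–23] -/
theorem abc_of_cor312OnSigma27 (h312 : Cor312OnSigma27)
    (hNumBad : ∀ (P : NFPoint), P ∈ UP → ∀ (l : ℕ), l.Prime → 5 ≤ l →
      Cor22.AdmitsCore P → Cor22.CondP2 P l → Cor22.CondP5 P l → Cor22.CondP6 P l →
      -- ONLY at SZPIRO-BAD `(P, l)`: elsewhere `T.Cor312Of` is the theorem `Cor22.ThetaVolumeDatumAt.cor312Of_of_szpiro` (abc-iut-c312-d1)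
      (((l : ℝ) + 5) / 4 < (Cor22.dmod P : ℝ) ∨
        6 * l * (((l : ℝ) + 5) - 4 * Cor22.dmod P) / (((l : ℝ) + 4) * ((l : ℝ) - 3))
            * (P.logDiff + (1 - 1 / (l : ℝ)) * Cor22.logCondAvoid P {2, l})
          + 6 * l * ((l : ℝ) + 5) / (((l : ℝ) + 4) * ((l : ℝ) - 3)) * Real.log Real.pi < Cor22.logQAvoid P {2, l}) →
      ∀ (T : Cor22.ThetaVolumeDatumAt P l), letI := T.instFieldF; letI := T.instNumberFieldF; letI := T.instAlgebraF; letI := T.instFieldK;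
        letI := T.instNumberFieldK; letI := T.instAlgebraK; letI := T.instFieldFbar; letI := T.instAlgebraFbar;
        letI := T.instAlgebraKFbar; letI := T.instIsElliptic;
      (∃ (pp : Nat.Primes) (_ : 2 < (pp : ℕ)) (i : Fin (thetaIndex (pilotDataOfK T.D T.K)).lstar)
          (x₀ : (thetaIndex (pilotDataOfK T.D T.K)).Fibre (.inr pp)),
        haveI : Fact (pp : ℕ).Prime := ⟨pp.2⟩
        ((pp : ℕ) : ℝ) ^ ((((i : ℕ) : ℝ) + 2) * (4 + 2 * Real.logb (pp : ℕ) (Module.finrank ℚ T.K)) + 1) *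
          ‖(exists_realising_qIdeles_pilotDataOfK T.D).choose pp x₀‖ ^ (((i : ℕ) + 1) ^ 2 - 1) < 1) → T.Cor312Of)
    (hreg : ∀ P : NFPoint, P ∈ UP → ∀ l : ℕ, l.Prime → 5 ≤ l →
      Cor22.AdmitsCore P → Cor22.CondP2 P l → Cor22.CondP5 P l → Cor22.CondP6 P l →
      ∀ T : Cor22.ThetaVolumeDatumAt P l,
        (letI := T.instFieldF; letI := T.instNumberFieldF; letI := T.instAlgebraF; letI := T.instFieldK
         letI := T.instNumberFieldK; letI := T.instAlgebraK; letI := T.instFieldFbar; letI := T.instAlgebraFbar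
         letI := T.instAlgebraKFbar; letI := T.instIsElliptic
         ¬ (∀ p ∈ T.I.supportPrimes, ∀ v w : placesOver (fieldOfModuli T.E) p,
            (Summit.ABC.IUTFork.DHData.ofInput T.I).logQloc p v = (Summit.ABC.IUTFork.DHData.ofInput T.I).logQloc p w)) →
        T.HullEstimateOf
          (((l : ℝ) + 1) / 4 *
            ((1 + 12 * (Cor22.dmod P : ℝ) / l) * (P.logDiff + Cor22.logCondAvoid P {2, l})
              + 2 * Real.log l + 52
              + 20 / 3 * Real.log (((2 ^ 12 * 3 ^ 3 * 5 * Cor22.dmod P : ℕ) : ℝ) * (l : ℝ))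
                * (Nat.primeCounting (2 ^ 12 * 3 ^ 3 * 5 * Cor22.dmod P * l) : ℝ))))
    : _root_.ABC := by
  refine ThetaPartII.ABC_of_cor312_of_hullRegime (fun P hP l hl h5 hc h2 h5' h6 T => ?_) hreg
  refine Cor22.forall_cor312Of_of_szpiroBad hP.1 h5 (fun _ => True) (fun hbad T _ => ?_) T trivial
  letI := T.instFieldF; letI := T.instNumberFieldF; letI := T.instAlgebraF; letI := T.instFieldK
  letI := T.instNumberFieldK; letI := T.instAlgebraK; letI := T.instFieldFbar; letI := T.instAlgebraFbar
  letI := T.instAlgebraKFbar; letI := T.instIsElliptic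
  by_cases hdeep : (∃ (pp : Nat.Primes) (_ : 2 < (pp : ℕ)) (i : Fin (thetaIndex (pilotDataOfK T.D T.K)).lstar)
        (x₀ : (thetaIndex (pilotDataOfK T.D T.K)).Fibre (.inr pp)),
      haveI : Fact (pp : ℕ).Prime := ⟨pp.2⟩
      ((pp : ℕ) : ℝ) ^ ((((i : ℕ) : ℝ) + 2) * (4 + 2 * Real.logb (pp : ℕ) (Module.finrank ℚ T.K)) + 1) *
        ‖(exists_realising_qIdeles_pilotDataOfK T.D).choose pp x₀‖ ^ (((i : ℕ) + 1) ^ 2 - 1) < 1)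
  · exact hNumBad P hP l hl h5 hc h2 h5' h6 hbad T hdeep
  · exact T.cor312Of_of_nonarch (h312 P hP l hl h5 hc h2 h5' h6 hbad T hdeep)

/-- **COMPOSITE Q2(27): `K2Target27 ∧ HStar27OnSigma27 ∧ NUM(deep ∧ bad) ∧ CONE ⟹ ABC`** — «S restricted to Σ₂₇ ⇒ Cor 3.12 on Σ₂₇ ⇒ abc» with the
first arrow an explicit TARGET binder and the second arrow proved. [claim: Mochizuki2012, status: disputed] -/
theorem abc_of_k2Target27_of_hStar27OnSigma27 (hK2 : K2Target27) (hS : HStar27OnSigma27)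
    (hNumBad : ∀ (P : NFPoint), P ∈ UP → ∀ (l : ℕ), l.Prime → 5 ≤ l →
      Cor22.AdmitsCore P → Cor22.CondP2 P l → Cor22.CondP5 P l → Cor22.CondP6 P l →
      -- ONLY at SZPIRO-BAD `(P, l)`: elsewhere `T.Cor312Of` is the theorem `Cor22.ThetaVolumeDatumAt.cor312Of_of_szpiro` (abc-iut-c312-d1)
      (((l : ℝ) + 5) / 4 < (Cor22.dmod P : ℝ) ∨
        6 * l * (((l : ℝ) + 5) - 4 * Cor22.dmod P) / (((l : ℝ) + 4) * ((l : ℝ) - 3))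
            * (P.logDiff + (1 - 1 / (l : ℝ)) * Cor22.logCondAvoid P {2, l})
          + 6 * l * ((l : ℝ) + 5) / (((l : ℝ) + 4) * ((l : ℝ) - 3)) * Real.log Real.pi < Cor22.logQAvoid P {2, l}) →
      ∀ (T : Cor22.ThetaVolumeDatumAt P l), letI := T.instFieldF; letI := T.instNumberFieldF; letI := T.instAlgebraF; letI := T.instFieldK;
        letI := T.instNumberFieldK; letI := T.instAlgebraK; letI := T.instFieldFbar; letI := T.instAlgebraFbar;
        letI := T.instAlgebraKFbar; letI := T.instIsElliptic;
      (∃ (pp : Nat.Primes) (_ : 2 < (pp : ℕ)) (i : Fin (thetaIndex (pilotDataOfK T.D T.K)).lstar)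
          (x₀ : (thetaIndex (pilotDataOfK T.D T.K)).Fibre (.inr pp)),
        haveI : Fact (pp : ℕ).Prime := ⟨pp.2⟩
        ((pp : ℕ) : ℝ) ^ ((((i : ℕ) : ℝ) + 2) * (4 + 2 * Real.logb (pp : ℕ) (Module.finrank ℚ T.K)) + 1) *
          ‖(exists_realising_qIdeles_pilotDataOfK T.D).choose pp x₀‖ ^ (((i : ℕ) + 1) ^ 2 - 1) < 1) → T.Cor312Of)
    (hreg : ∀ P : NFPoint, P ∈ UP → ∀ l : ℕ, l.Prime → 5 ≤ l →
      Cor22.AdmitsCore P → Cor22.CondP2 P l → Cor22.CondP5 P l → Cor22.CondP6 P l →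
      ∀ T : Cor22.ThetaVolumeDatumAt P l,
        (letI := T.instFieldF; letI := T.instNumberFieldF; letI := T.instAlgebraF; letI := T.instFieldK
         letI := T.instNumberFieldK; letI := T.instAlgebraK; letI := T.instFieldFbar; letI := T.instAlgebraFbar
         letI := T.instAlgebraKFbar; letI := T.instIsElliptic
         ¬ (∀ p ∈ T.I.supportPrimes, ∀ v w : placesOver (fieldOfModuli T.E) p,
            (Summit.ABC.IUTFork.DHData.ofInput T.I).logQloc p v = (Summit.ABC.IUTFork.DHData.ofInput T.I).logQloc p w)) →
        T.HullEstimateOf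
          (((l : ℝ) + 1) / 4 *
            ((1 + 12 * (Cor22.dmod P : ℝ) / l) * (P.logDiff + Cor22.logCondAvoid P {2, l})
              + 2 * Real.log l + 52
              + 20 / 3 * Real.log (((2 ^ 12 * 3 ^ 3 * 5 * Cor22.dmod P : ℕ) : ℝ) * (l : ℝ))
                * (Nat.primeCounting (2 ^ 12 * 3 ^ 3 * 5 * Cor22.dmod P * l) : ℝ))))
    : _root_.ABC :=
  abc_of_cor312OnSigma27 (cor312OnSigma27_of_k2Target27 hK2 hS) hNumBad hreg

end Summit.ABC.IUTFork.Repair.RH.ReachLedgerQ2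

end
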